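import Summits.QuantumFields.YangMills.Theorems.BalabanUVNodesSpineReadingOfRecord13CoPHKComponentSizeBlocksInside
import Summits.QuantumFields.YangMills.Theorems.BalabanUVNodesSpineReadingOfRecord13CoPHKForgive
import Literature.MathematicalPhysics.QuantumFieldTheory.Balaban1983to89.Node00.TwoRunSiteBlockSaturation

/-!
# THE INSIDE-EVENT FACE AT THE COMPONENT-WISE FORGIVING KEY READING `forgiveCompReading₁₃ K₀ c`: the forgiving window forgets the entries at the levels `1 ≤ j ≤ c … K` and
# fills, in every kept entry, the components of the hole meeting the floor region — its large-field regions are UNIONS OF COMPONENTS of the record's, hence block-saturated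
# (`Node00.blockSaturated_compl_forgiveKeyComp_snd`: blocks are connected), so the saturation hypothesis `hsat` of `…BlocksInside` is DISCHARGED at every floor reading `c`

Cell `pub-ymgap`, YM-PLAN Track A (HUMAN RULING D-0062; width push D-0149); seat `pub-ymgap-dag-n20-d` (R134 (a) N20 NE7b s3 = the U5d ∕ `crOfRecord₁₃` lineage, its declarer)
gen 33; companion of `…CoPHKComponentSizeBlocksInside` (gen 33: `blockSaturated_of_mem_classSet₁₃`, `relWeightBound_card_of_insideBlockEnergyLetters_geometric`), of
`…CoPHKComponentSizeBlocksWindow` (gen 33: the level-window twin), of the K-kit's forgiving reading (`…CoPHKForgive` §1 `forgiveCompReading₁₃`; floor `0` = the identity reading,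
`forgiveCompReading₁₃_zero`) and of `Node00/TwoRunSiteBlockSaturation` (gen 33: ★ `connIn_iterBlock_of_iterBlockOf_eq` — blocks are `SiteTouch`-connected — and
`blockSaturated_compl_forgiveKeyComp_snd`).  `--kind proof --supports stmt-QuantumFields-27366 --as helper` (K3⁸); COUNT-NEUTRAL; THEOREMS ONLY (0 `def`).
WHY.  The component-wise forgiving window (`Node00.forgiveKeyComp`, [LF-II] (1.85) p. 386's «old structure with its growth and its mergers leaves the key») is the K-kit reading
under which un-absorbed BIRTHS in the window stay and everything connected to the floor region is forgiven; its `j`-th large-field region is `∅` (forgotten levels) or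
`(forgive SiteTouch R Λ_j)ᶜ` = the components of `Z_j = Λ_jᶜ` NOT meeting the floor region `R`.  Components of block-saturated regions are block-saturated because a block is
`SiteTouch`-connected (`Node00/TwoRunSiteBlockSaturation`), so `hsat` holds at every forgiving reading and the INSIDE block energy letters give the N20 face there — the size
dial then counts big components among the NEW births of the window only.
WHAT IS HERE.  §1 ★ `hsat_forgiveCompReading₁₃_of_dvd ∕ hsat_forgiveCompReading₁₃` (the `hsat` shape at the forgiving reading, modulo the two cube-side divisibilities ∕ none for
`lv K j ≤ j`) and `fst_forgiveCompReading₁₃_of_mem_classSet₁₃`; §2 ★★★ `relWeightBound_card_of_insideBlockEnergyLetters_forgive_of_dvd` and ★★★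
`relWeightBound_card_of_insideBlockEnergyLetters_forgive` (INSIDE block letters at the forgiving reading's coarse classes, uniformly small, threshold schedule ⇒ `RelWeightBound`
with the geometric weight `δ₀ · 2^{−(K+1)}`).
HONEST FRAMING.  [folklore] bookkeeping BY NAME over gen-33's geometry; the INSIDE block energy letters are HYPOTHESES (inhabited for no family today; NOT PRINTED as two-run
statements; LCS-shaped; print's per-size factors are (1.85)'s `γ₀A₁p₀²(g_{j+1})(d′+1)` for NEW regions ∕ (1.89)'s `κ₁d_k(X)`, ABSOLUTE per term — `…BlocksInside` v1.1 ERRATUM);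
NO weight is bounded, NO estimate proved; nothing of Bałaban's asserted; NE7 ∕ NE7b ∕ NE7c NOT PRINTED for `d = 4` ∕ NOT proved; no `Provisos₁₃CoPH` inhabitant claimed (K0⁷ OPEN);
K3⁸ v7 untouched; N19 ∕ N20 ∕ N21 ∕ N27 NOT discharged; counts UNMOVED (typed 28∕28 · discharged 8∕27); one finite four-torus programme at fixed `ε` — NOT ℝ⁴, NOT OS, NOT a mass gap,
NOT the Clay problem.  No `def`, no `instance`, no `notation`, no `sorry`; no cite tags below.
-/

noncomputable section

open scoped BigOperators
open Finset

namespace YMDAG.UVSplit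

open Literature.MathematicalPhysics.QuantumFieldTheory.Balaban1983to89
open Literature.MathematicalPhysics.QuantumFieldTheory.Balaban1983to89.T4Continuum
open Literature.MathematicalPhysics.QuantumFieldTheory.Balaban1983to89.Node00
open Literature.MathematicalPhysics.QuantumFieldTheory.Balaban1983to89.B5Eq118OneStroke (iterBlockOf iterBlock)
open T4WeightBudget (RelWeightBound)

variable {F : T4Family} {N : ℕ} [NeZero N]

/-! ## §1 `hsat` at the component-wise forgiving reading -/

section Saturation

variable (θ : Stage13HParams F N) (hP : θ.Provisos₁₃CoPH F N) (K₀ : ℕ) (g₀ : ℕ → ℝ) (os : List (ULoop F))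

/-- ★ **`hsat` AT THE FORGIVING READING, modulo the two cube-side divisibilities**: every coarse class of `forgiveCompReading₁₃ K₀ c` at step `K` is the component-wise forgiving
window of a class of record `⟨K, x⟩`; the record's regions are `lv K j`-block-saturated when `L^{lv K j}` divides both runs' level-`j` cube sides (`blockSaturated_of_mem_classSet₁₃`),
and the forgiving window keeps that (`Node00.blockSaturated_compl_forgiveKeyComp_snd`). [bookkeeping] -/
theorem hsat_forgiveCompReading₁₃_of_dvd (c : FloorReading₁₃ N) (lv : ℕ → ℕ → ℕ) (hlv : ∀ K j, lv K j ≤ F.m + (K₀ + K)) (K j : ℕ)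
    (hdvA : F.L ^ lv K j ∣ dCubeSide F.L θ.τ9.M (RkOfRecord F.L θ.ν.r (histA₁₃ θ K₀ g₀ K j)) j)
    (hdvB : F.L ^ lv K j ∣ dCubeSide F.L θ.τ9.M (RkOfRecord F.L θ.ν.r (histB₁₃ θ K₀ g₀ K (j + 1))) j) :
    ∀ u ∈ classSetK₁₃ θ K₀ g₀ (forgiveCompReading₁₃ K₀ c F θ hP g₀ os) K, ∀ y : SiteSeqKey F (K₀ + K), u = ⟨K, y⟩ →
      ∀ ⦃z z' : Site (F.P (K₀ + K)) 0⦄, iterBlockOf (lv K j) z = iterBlockOf (lv K j) z' → z ∈ (y.2 j)ᶜ → z' ∈ (y.2 j)ᶜ := by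
  intro u hu y hy
  obtain ⟨x, hx, hxu⟩ := (mem_classSetK₁₃_iff θ K₀ g₀ _ K u).1 hu
  obtain ⟨K', x2⟩ := x
  have hK' : K' = K := fst_eq_of_mem_classSet₁₃ θ K₀ g₀ hx
  subst hK'
  have hfg : forgiveCompReading₁₃ K₀ c F θ hP g₀ os K' ⟨K', x2⟩ = ⟨K', forgiveKeyComp F (c F θ hP g₀ os K') x2⟩ := rfl
  rw [hfg] at hxu
  have hyx : y = forgiveKeyComp F (c F θ hP g₀ os K') x2 := (eq_of_heq (Sigma.mk.inj (hxu.trans hy)).2).symm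
  rw [hyx]
  exact blockSaturated_compl_forgiveKeyComp_snd F (hlv K' j) (c F θ hP g₀ os K') j x2
    (fun _ _ hzz hz => blockSaturated_of_mem_classSet₁₃ θ K₀ g₀ K' (hlv K' j) hdvA hdvB hx hzz hz)

/-- ★ … and for block levels `lv K j ≤ j` with NO divisibility hypothesis. [bookkeeping] -/
theorem hsat_forgiveCompReading₁₃ (c : FloorReading₁₃ N) (lv : ℕ → ℕ → ℕ) (hlv : ∀ K j, lv K j ≤ F.m + (K₀ + K)) (K j : ℕ) (hlvj : lv K j ≤ j) :
    ∀ u ∈ classSetK₁₃ θ K₀ g₀ (forgiveCompReading₁₃ K₀ c F θ hP g₀ os) K, ∀ y : SiteSeqKey F (K₀ + K), u = ⟨K, y⟩ →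
      ∀ ⦃z z' : Site (F.P (K₀ + K)) 0⦄, iterBlockOf (lv K j) z = iterBlockOf (lv K j) z' → z ∈ (y.2 j)ᶜ → z' ∈ (y.2 j)ᶜ :=
  hsat_forgiveCompReading₁₃_of_dvd θ hP K₀ g₀ os c lv hlv K j (pow_dvd_dCubeSide_of_le _ _ _ hlvj) (pow_dvd_dCubeSide_of_le _ _ _ hlvj)

/-- The forgiving reading is step-preserving on the class set of record (`forgiveCompReading₁₃_fst` + `fst_eq_of_mem_classSet₁₃`). [bookkeeping] -/
theorem fst_forgiveCompReading₁₃_of_mem_classSet₁₃ (c : FloorReading₁₃ N) (K : ℕ) (x : Σ K, SiteSeqKey F (K₀ + K)) (hx : x ∈ classSet₁₃ θ K₀ g₀ K) :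
    (forgiveCompReading₁₃ K₀ c F θ hP g₀ os K x).1 = K := by
  rw [forgiveCompReading₁₃_fst]
  exact fst_eq_of_mem_classSet₁₃ θ K₀ g₀ hx

end Saturation

/-! ## §2 The face from INSIDE block energy letters at the forgiving reading -/

section Face

variable (θ : Stage13HParams F N) (hP : θ.Provisos₁₃CoPH F N) (K₀ : ℕ) (g₀ : ℕ → ℝ) (os : List (ULoop F)) (c : FloorReading₁₃ N) (jcut : ℕ → ℕ)
  (n lv : ℕ → ℕ → ℕ)

/-- ★★★ **THE N20 FACE AT THE FORGIVING READING FROM INSIDE BLOCK ENERGY LETTERS**, block levels as coarse as the divisibilities `L^{lv K j} ∣ L^j · M · R_j` of the two runs allow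
(`1 ≤ j ≤ jcut K`): uniformly small INSIDE letters (`0 ≤ δ K j ≤ δ₀`, `2·(3^4 − 1)²·δ₀ ≤ 1`) at the coarse classes of `forgiveCompReading₁₃ K₀ c` in both runs, under the threshold
schedule `n K j ≥ ⌈log₂ |Site_{lv K j}|⌉ + K + j + 3`, give `RelWeightBound` at the forgiving reading's carriers with the geometric weight `δ₀ · 2^{−(K+1)}`. [bookkeeping] -/
theorem relWeightBound_card_of_insideBlockEnergyLetters_forgive_of_dvd
    {δ : ℕ → ℕ → ℝ} {δ₀ : ℝ} (hδ0 : ∀ K j, 0 ≤ δ K j) (hδ1 : ∀ K j, δ K j ≤ δ₀) (hD : 2 * ((3 : ℝ) ^ 4 - 1) ^ 2 * δ₀ ≤ 1)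
    (hn : ∀ K j, Nat.clog 2 (Fintype.card (Site (F.P (K₀ + K)) (lv K j))) + K + j + 3 ≤ n K j) (hlv : ∀ K j, lv K j ≤ F.m + (K₀ + K))
    (hdvA : ∀ K, ∀ j ∈ Finset.Icc 1 (jcut K), F.L ^ lv K j ∣ dCubeSide F.L θ.τ9.M (RkOfRecord F.L θ.ν.r (histA₁₃ θ K₀ g₀ K j)) j)
    (hdvB : ∀ K, ∀ j ∈ Finset.Icc 1 (jcut K), F.L ^ lv K j ∣ dCubeSide F.L θ.τ9.M (RkOfRecord F.L θ.ν.r (histB₁₃ θ K₀ g₀ K (j + 1))) j)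
    (hEA : ∀ (K : ℕ) (t : ℝ), |t| ≤ 1 → ∀ j ∈ Finset.Icc 1 (jcut K), ∀ p ∈ animalCoverFamily (SiteTouch (P := F.P (K₀ + K)) (j := lv K j)) (n K j),
      ∑ u ∈ badClassK₁₃ θ K₀ g₀ (forgiveCompReading₁₃ K₀ c F θ hP g₀ os) (fun _ u => ∀ y : SiteSeqKey F (K₀ + K), u = ⟨K, y⟩ →
          ∀ b ∈ p.2, (↑(iterBlock (lv K j) b) : Set (Site (F.P (K₀ + K)) 0)) ⊆ (y.2 j)ᶜ) K t,
          weightAK₁₃ θ hP K₀ g₀ os (forgiveCompReading₁₃ K₀ c F θ hP g₀ os) K t u ≤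
        δ K j ^ n K j * ∑ u ∈ classSetK₁₃ θ K₀ g₀ (forgiveCompReading₁₃ K₀ c F θ hP g₀ os) K, weightAK₁₃ θ hP K₀ g₀ os (forgiveCompReading₁₃ K₀ c F θ hP g₀ os) K t u)
    (hEB : ∀ (K : ℕ) (t : ℝ), |t| ≤ 1 → ∀ j ∈ Finset.Icc 1 (jcut K), ∀ p ∈ animalCoverFamily (SiteTouch (P := F.P (K₀ + K)) (j := lv K j)) (n K j),
      ∑ u ∈ badClassK₁₃ θ K₀ g₀ (forgiveCompReading₁₃ K₀ c F θ hP g₀ os) (fun _ u => ∀ y : SiteSeqKey F (K₀ + K), u = ⟨K, y⟩ →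
          ∀ b ∈ p.2, (↑(iterBlock (lv K j) b) : Set (Site (F.P (K₀ + K)) 0)) ⊆ (y.2 j)ᶜ) K t,
          weightBK₁₃ θ hP K₀ g₀ os (forgiveCompReading₁₃ K₀ c F θ hP g₀ os) K t u ≤
        δ K j ^ n K j * ∑ u ∈ classSetK₁₃ θ K₀ g₀ (forgiveCompReading₁₃ K₀ c F θ hP g₀ os) K, weightBK₁₃ θ hP K₀ g₀ os (forgiveCompReading₁₃ K₀ c F θ hP g₀ os) K t u) :
    RelWeightBound 1 (classSetK₁₃ θ K₀ g₀ (forgiveCompReading₁₃ K₀ c F θ hP g₀ os)) (weightAK₁₃ θ hP K₀ g₀ os (forgiveCompReading₁₃ K₀ c F θ hP g₀ os))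
      (weightBK₁₃ θ hP K₀ g₀ os (forgiveCompReading₁₃ K₀ c F θ hP g₀ os))
      (badClassK₁₃ θ K₀ g₀ (forgiveCompReading₁₃ K₀ c F θ hP g₀ os)
        (badKeyReadingOfBigComponent₁₃ N K₀ jcut (bigDialOfCard₁₃ K₀ (fun K j => n K j * (F.L ^ 4) ^ lv K j)) F θ hP g₀ os))
      (fun K => δ₀ * (1 / 2) ^ (K + 1)) :=
  relWeightBound_card_of_insideBlockEnergyLetters_geometric θ hP K₀ g₀ os (forgiveCompReading₁₃ K₀ c F θ hP g₀ os) jcut n lv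
    (fun K x hx => fst_forgiveCompReading₁₃_of_mem_classSet₁₃ θ hP K₀ g₀ os c K x hx) hδ0 hδ1 hD hn hlv
    (fun K j hj => hsat_forgiveCompReading₁₃_of_dvd θ hP K₀ g₀ os c lv hlv K j (hdvA K j hj) (hdvB K j hj)) hEA hEB

/-- ★★★ **… BLOCK LEVELS `lv K j ≤ j`: NO SATURATION ∕ DIVISIBILITY HYPOTHESIS LEFT** at the forgiving reading `forgiveCompReading₁₃ K₀ c` (any floor reading `c`; floor `0` =
`…BlocksInside`'s `relWeightBound_card_of_insideBlockEnergyLetters_id` by `forgiveCompReading₁₃_zero`). [bookkeeping] -/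
theorem relWeightBound_card_of_insideBlockEnergyLetters_forgive
    {δ : ℕ → ℕ → ℝ} {δ₀ : ℝ} (hδ0 : ∀ K j, 0 ≤ δ K j) (hδ1 : ∀ K j, δ K j ≤ δ₀) (hD : 2 * ((3 : ℝ) ^ 4 - 1) ^ 2 * δ₀ ≤ 1)
    (hn : ∀ K j, Nat.clog 2 (Fintype.card (Site (F.P (K₀ + K)) (lv K j))) + K + j + 3 ≤ n K j) (hlv : ∀ K j, lv K j ≤ F.m + (K₀ + K))
    (hlvj : ∀ K, ∀ j ∈ Finset.Icc 1 (jcut K), lv K j ≤ j)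
    (hEA : ∀ (K : ℕ) (t : ℝ), |t| ≤ 1 → ∀ j ∈ Finset.Icc 1 (jcut K), ∀ p ∈ animalCoverFamily (SiteTouch (P := F.P (K₀ + K)) (j := lv K j)) (n K j),
      ∑ u ∈ badClassK₁₃ θ K₀ g₀ (forgiveCompReading₁₃ K₀ c F θ hP g₀ os) (fun _ u => ∀ y : SiteSeqKey F (K₀ + K), u = ⟨K, y⟩ →
          ∀ b ∈ p.2, (↑(iterBlock (lv K j) b) : Set (Site (F.P (K₀ + K)) 0)) ⊆ (y.2 j)ᶜ) K t,
          weightAK₁₃ θ hP K₀ g₀ os (forgiveCompReading₁₃ K₀ c F θ hP g₀ os) K t u ≤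
        δ K j ^ n K j * ∑ u ∈ classSetK₁₃ θ K₀ g₀ (forgiveCompReading₁₃ K₀ c F θ hP g₀ os) K, weightAK₁₃ θ hP K₀ g₀ os (forgiveCompReading₁₃ K₀ c F θ hP g₀ os) K t u)
    (hEB : ∀ (K : ℕ) (t : ℝ), |t| ≤ 1 → ∀ j ∈ Finset.Icc 1 (jcut K), ∀ p ∈ animalCoverFamily (SiteTouch (P := F.P (K₀ + K)) (j := lv K j)) (n K j),
      ∑ u ∈ badClassK₁₃ θ K₀ g₀ (forgiveCompReading₁₃ K₀ c F θ hP g₀ os) (fun _ u => ∀ y : SiteSeqKey F (K₀ + K), u = ⟨K, y⟩ →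
          ∀ b ∈ p.2, (↑(iterBlock (lv K j) b) : Set (Site (F.P (K₀ + K)) 0)) ⊆ (y.2 j)ᶜ) K t,
          weightBK₁₃ θ hP K₀ g₀ os (forgiveCompReading₁₃ K₀ c F θ hP g₀ os) K t u ≤
        δ K j ^ n K j * ∑ u ∈ classSetK₁₃ θ K₀ g₀ (forgiveCompReading₁₃ K₀ c F θ hP g₀ os) K, weightBK₁₃ θ hP K₀ g₀ os (forgiveCompReading₁₃ K₀ c F θ hP g₀ os) K t u) :
    RelWeightBound 1 (classSetK₁₃ θ K₀ g₀ (forgiveCompReading₁₃ K₀ c F θ hP g₀ os)) (weightAK₁₃ θ hP K₀ g₀ os (forgiveCompReading₁₃ K₀ c F θ hP g₀ os))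
      (weightBK₁₃ θ hP K₀ g₀ os (forgiveCompReading₁₃ K₀ c F θ hP g₀ os))
      (badClassK₁₃ θ K₀ g₀ (forgiveCompReading₁₃ K₀ c F θ hP g₀ os)
        (badKeyReadingOfBigComponent₁₃ N K₀ jcut (bigDialOfCard₁₃ K₀ (fun K j => n K j * (F.L ^ 4) ^ lv K j)) F θ hP g₀ os))
      (fun K => δ₀ * (1 / 2) ^ (K + 1)) :=
  relWeightBound_card_of_insideBlockEnergyLetters_forgive_of_dvd θ hP K₀ g₀ os c jcut n lv hδ0 hδ1 hD hn hlv
    (fun K j hj => pow_dvd_dCubeSide_of_le _ _ _ (hlvj K j hj)) (fun K j hj => pow_dvd_dCubeSide_of_le _ _ _ (hlvj K j hj)) hEA hEB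

end Face

end YMDAG.UVSplit

end
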